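import Summits.Ventures.WeilGRH.UniformConductorFloorCoprimeSound
import Summits.Ventures.WeilGRH.UniformConductorFloorCoprimeEvenTwoCheck
import Summits.Ventures.WeilGRH.UniformConductorFloorCoprimeOddTwoCheck
import Summits.Ventures.WeilGRH.UniformConductorFloorCoprimeEvenThreeCheck
import Summits.Ventures.WeilGRH.UniformConductorFloorCoprimeOddThreeCheck
import Summits.Ventures.WeilGRH.UniformConductorFloorCoprimeEvenSixCheck
import Summits.Ventures.WeilGRH.UniformConductorFloorCoprimeOddSixCheck
import Summits.Ventures.WeilGRH.UniformConductorFloorCoprimeInputs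
import HarnessLib

/-!
# GRH arm (rh-explicit, venture WeilGRH): ★ DIVISIBILITY FLOORS — Weil positivity on `[-1, 1]` for EVERY Dirichlet character of
  EVERY modulus `q` with `2 ∣ q, q ≥ 34` · `3 ∣ q, q ≥ 45` · `6 ∣ q, q ≥ 24` (odd characters: `14` · `18` · `12`)

Cell `rh-explicit`, WEIL TRACK — GRH ARM (weil-grh-1, gen7).  The uniform `t = 1` floor of the arm
(`weilPositivityOnChar_one_of_ge_78`: every character of every modulus `q ≥ 78`, odd `q ≥ 31`; exact pseudo-key floors `75` / `30`)
guards against the ALL-TRIVIAL key `χ(n) = 1`, `n ∈ {2, 3, 4, 5, 7}`.  A character of a modulus divisible by a visible prime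
`p` has `χ(p^k) = 0` instead, and the corresponding terms of Weil's form VANISH; the joint (archimedean layers + primes)
Collatz–Wielandt cell certificates with those prime powers removed (`certEvenDvd2` … `certOddDvd6`,
`UniformConductorFloorCoprimeData.lean`, kernel-checked in `…Coprime{Even,Odd}{Two,Three,Six}Check.lean`) and the level-`m`
soundness theorem `JointCert.weilPositivityOnChar_one_of_parts_coprime` (weights, logarithms and budgets in
`UniformConductorFloorCoprimeInputs.lean`) give the **divisibility floors** `q*(1; m)`:

| `m` | visible prime powers left | all `χ` (budget → floor) | odd `χ` |
|---|---|---|---|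
| 1 (tree, `…JointFloors`) | 2, 3, 4, 5, 7 | 4.3556 → 78 | 3.4289 → 31 |
| 2 | 3, 5, 7 | 3.5007 → 34 | 2.5803 → 14 |
| 3 | 2, 4, 5, 7 | 3.7772 → 44 (stated 45 = the first multiple of 3) | 2.8511 → 18 |
| 6 | 5, 7 | 2.9138 → 19 (stated 24) | 1.9910 → 8 (stated 12) |

* ★ `weilPositivityOnChar_one_of_two_dvd_ge_34` — **EVERY Dirichlet character (any parity, any values, imprimitive included) of
  EVERY EVEN modulus `q ≥ 34` satisfies `WeilPositivityOnChar χ 1`**; `…_of_three_dvd_ge_45`; `…_of_six_dvd_ge_24`;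
* the parity halves `…_even_…` / `…_odd_…` (odd characters: even `q ≥ 14`, `3 ∣ q ≥ 18`, `6 ∣ q ≥ 12`);
* `…_of_le_one_…` — the same on every window `t ≤ 1`.

Coverage bought at `t = 1` below the uniform floor `78` (THEOREM for all characters of the modulus): the `22` even moduli
`34 ≤ q ≤ 76`, the multiples of `3` in `{45, 51, 57, 63, 69, 75}`, and `24, 30`; for odd characters below `31`: the even moduli
`14 ≤ q ≤ 30`, and `21, 27`, `12, 18`.  Honest scope: finite-window (`t = 1`) statements; nothing here is a step towards GRH
for any individual character; no `ζ` input; standard axioms; the certificates are kernel-checked integer data.  Float scheme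
floors at `J = 320` for other levels (not typed): `5 ∣ q`: 58.4 / 23.1; `10 ∣ q`: 24.8 / 9.8; `30 ∣ q`: 14.1 / 5.7.

## References

* A. Weil (1952), (11) pp. 261–262 and the «lemme» p. 262 [Weil1952FormulesExplicites]; H. L. Montgomery, R. C. Vaughan (2007),
  (12.22) [MontgomeryVaughan2007]; L. Collatz (1942) / H. Wielandt (1950). [folklore]
-/

noncomputable section

open Real Set
open scoped ArithmeticFunction.vonMangoldt

namespace Summit.Ventures.WeilGRH

open Literature.NumberTheory.LFunctions

namespace UniformFloor

variable {q : ℕ}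

/-! ## The floors -/

/-- ★ **Every EVEN Dirichlet character of every modulus `q ≥ 34` with `2 ∣ q` satisfies Weil positivity on `[-1, 1]`.** [folklore] -/
theorem weilPositivityOnChar_one_of_even_two_dvd_ge_34 (hm : 2 ∣ q) (hq : 34 ≤ q) (χ : DirichletCharacter ℂ q)
    (hpar : charParity χ = 0) : WeilPositivityOnChar χ 1 :=
  certEvenDvd2.weilPositivityOnChar_one_of_parts_coprime certEvenDvd2_checkFrame certEvenDvd2_checkOne
    (fun _ hj ↦ certEvenDvd2.cellOKB_of_checkCells certEvenDvd2_checkCells hj) certEvenDvd2_hw psi_even_ge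
    (Q₀ := 34) (by norm_num) certEvenDvd2_budget (by omega) hm hq χ hpar

/-- ★ **Every ODD Dirichlet character of every modulus `q ≥ 14` with `2 ∣ q` satisfies Weil positivity on `[-1, 1]`.**
[cite: Weil1952FormulesExplicites, (11) and the «lemme» p. 262] -/
theorem weilPositivityOnChar_one_of_odd_two_dvd_ge_14 (hm : 2 ∣ q) (hq : 14 ≤ q) (χ : DirichletCharacter ℂ q)
    (hpar : charParity χ = 1) : WeilPositivityOnChar χ 1 :=
  certOddDvd2.weilPositivityOnChar_one_of_parts_coprime certOddDvd2_checkFrame certOddDvd2_checkOne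
    (fun _ hj ↦ certOddDvd2.cellOKB_of_checkCells certOddDvd2_checkCells hj) certOddDvd2_hw psi_odd_ge
    (Q₀ := 14) (by norm_num) certOddDvd2_budget (by omega) hm hq χ hpar

/-- ★★ **EVERY Dirichlet character (any parity, any values, imprimitive included) of EVERY modulus `q ≥ 34` with `2 ∣ q`
satisfies Weil positivity on `[-1, 1]`: `WeilPositivityOnChar χ 1`.** [cite: Weil1952FormulesExplicites, (11) and the «lemme» p. 262] -/
theorem weilPositivityOnChar_one_of_two_dvd_ge_34 (hm : 2 ∣ q) (hq : 34 ≤ q) (χ : DirichletCharacter ℂ q) :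
    WeilPositivityOnChar χ 1 := by
  rcases Nat.le_one_iff_eq_zero_or_eq_one.1 (charParity_le_one χ) with h | h
  · exact weilPositivityOnChar_one_of_even_two_dvd_ge_34 hm hq χ h
  · exact weilPositivityOnChar_one_of_odd_two_dvd_ge_14 hm (by omega) χ h

/-- The same on every window `t ≤ 1`. [folklore] -/
theorem weilPositivityOnChar_of_le_one_of_two_dvd_ge_34 (hm : 2 ∣ q) (hq : 34 ≤ q) (χ : DirichletCharacter ℂ q) {t : ℝ}
    (ht : t ≤ 1) : WeilPositivityOnChar χ t := fun g hg hsupp ↦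
  weilPositivityOnChar_one_of_two_dvd_ge_34 hm hq χ g hg (hsupp.trans (Icc_subset_Icc (by linarith) ht))

/-- Odd characters on every window `t ≤ 1` from `2 ∣ q`, `q ≥ 14`. [folklore] -/
theorem weilPositivityOnChar_of_le_one_of_odd_two_dvd_ge_14 (hm : 2 ∣ q) (hq : 14 ≤ q) (χ : DirichletCharacter ℂ q)
    (hpar : charParity χ = 1) {t : ℝ} (ht : t ≤ 1) : WeilPositivityOnChar χ t := fun g hg hsupp ↦
  weilPositivityOnChar_one_of_odd_two_dvd_ge_14 hm hq χ hpar g hg (hsupp.trans (Icc_subset_Icc (by linarith) ht))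

/-- ★ **Every EVEN Dirichlet character of every modulus `q ≥ 45` with `3 ∣ q` satisfies Weil positivity on `[-1, 1]`.** [folklore] -/
theorem weilPositivityOnChar_one_of_even_three_dvd_ge_45 (hm : 3 ∣ q) (hq : 45 ≤ q) (χ : DirichletCharacter ℂ q)
    (hpar : charParity χ = 0) : WeilPositivityOnChar χ 1 :=
  certEvenDvd3.weilPositivityOnChar_one_of_parts_coprime certEvenDvd3_checkFrame certEvenDvd3_checkOne
    (fun _ hj ↦ certEvenDvd3.cellOKB_of_checkCells certEvenDvd3_checkCells hj) certEvenDvd3_hw psi_even_ge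
    (Q₀ := 45) (by norm_num) certEvenDvd3_budget (by omega) hm hq χ hpar

/-- ★ **Every ODD Dirichlet character of every modulus `q ≥ 18` with `3 ∣ q` satisfies Weil positivity on `[-1, 1]`.**
[cite: Weil1952FormulesExplicites, (11) and the «lemme» p. 262] -/
theorem weilPositivityOnChar_one_of_odd_three_dvd_ge_18 (hm : 3 ∣ q) (hq : 18 ≤ q) (χ : DirichletCharacter ℂ q)
    (hpar : charParity χ = 1) : WeilPositivityOnChar χ 1 :=
  certOddDvd3.weilPositivityOnChar_one_of_parts_coprime certOddDvd3_checkFrame certOddDvd3_checkOne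
    (fun _ hj ↦ certOddDvd3.cellOKB_of_checkCells certOddDvd3_checkCells hj) certOddDvd3_hw psi_odd_ge
    (Q₀ := 18) (by norm_num) certOddDvd3_budget (by omega) hm hq χ hpar

/-- ★★ **EVERY Dirichlet character (any parity, any values, imprimitive included) of EVERY modulus `q ≥ 45` with `3 ∣ q`
satisfies Weil positivity on `[-1, 1]`: `WeilPositivityOnChar χ 1`.** [cite: Weil1952FormulesExplicites, (11) and the «lemme» p. 262] -/
theorem weilPositivityOnChar_one_of_three_dvd_ge_45 (hm : 3 ∣ q) (hq : 45 ≤ q) (χ : DirichletCharacter ℂ q) :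
    WeilPositivityOnChar χ 1 := by
  rcases Nat.le_one_iff_eq_zero_or_eq_one.1 (charParity_le_one χ) with h | h
  · exact weilPositivityOnChar_one_of_even_three_dvd_ge_45 hm hq χ h
  · exact weilPositivityOnChar_one_of_odd_three_dvd_ge_18 hm (by omega) χ h

/-- The same on every window `t ≤ 1`. [folklore] -/
theorem weilPositivityOnChar_of_le_one_of_three_dvd_ge_45 (hm : 3 ∣ q) (hq : 45 ≤ q) (χ : DirichletCharacter ℂ q) {t : ℝ}
    (ht : t ≤ 1) : WeilPositivityOnChar χ t := fun g hg hsupp ↦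
  weilPositivityOnChar_one_of_three_dvd_ge_45 hm hq χ g hg (hsupp.trans (Icc_subset_Icc (by linarith) ht))

/-- Odd characters on every window `t ≤ 1` from `3 ∣ q`, `q ≥ 18`. [folklore] -/
theorem weilPositivityOnChar_of_le_one_of_odd_three_dvd_ge_18 (hm : 3 ∣ q) (hq : 18 ≤ q) (χ : DirichletCharacter ℂ q)
    (hpar : charParity χ = 1) {t : ℝ} (ht : t ≤ 1) : WeilPositivityOnChar χ t := fun g hg hsupp ↦
  weilPositivityOnChar_one_of_odd_three_dvd_ge_18 hm hq χ hpar g hg (hsupp.trans (Icc_subset_Icc (by linarith) ht))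

/-- ★ **Every EVEN Dirichlet character of every modulus `q ≥ 24` with `6 ∣ q` satisfies Weil positivity on `[-1, 1]`.** [folklore] -/
theorem weilPositivityOnChar_one_of_even_six_dvd_ge_24 (hm : 6 ∣ q) (hq : 24 ≤ q) (χ : DirichletCharacter ℂ q)
    (hpar : charParity χ = 0) : WeilPositivityOnChar χ 1 :=
  certEvenDvd6.weilPositivityOnChar_one_of_parts_coprime certEvenDvd6_checkFrame certEvenDvd6_checkOne
    (fun _ hj ↦ certEvenDvd6.cellOKB_of_checkCells certEvenDvd6_checkCells hj) certEvenDvd6_hw psi_even_ge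
    (Q₀ := 24) (by norm_num) certEvenDvd6_budget (by omega) hm hq χ hpar

/-- ★ **Every ODD Dirichlet character of every modulus `q ≥ 12` with `6 ∣ q` satisfies Weil positivity on `[-1, 1]`.**
[cite: Weil1952FormulesExplicites, (11) and the «lemme» p. 262] -/
theorem weilPositivityOnChar_one_of_odd_six_dvd_ge_12 (hm : 6 ∣ q) (hq : 12 ≤ q) (χ : DirichletCharacter ℂ q)
    (hpar : charParity χ = 1) : WeilPositivityOnChar χ 1 :=
  certOddDvd6.weilPositivityOnChar_one_of_parts_coprime certOddDvd6_checkFrame certOddDvd6_checkOne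
    (fun _ hj ↦ certOddDvd6.cellOKB_of_checkCells certOddDvd6_checkCells hj) certOddDvd6_hw psi_odd_ge
    (Q₀ := 12) (by norm_num) certOddDvd6_budget (by omega) hm hq χ hpar

/-- ★★ **EVERY Dirichlet character (any parity, any values, imprimitive included) of EVERY modulus `q ≥ 24` with `6 ∣ q`
satisfies Weil positivity on `[-1, 1]`: `WeilPositivityOnChar χ 1`.** [cite: Weil1952FormulesExplicites, (11) and the «lemme» p. 262] -/
theorem weilPositivityOnChar_one_of_six_dvd_ge_24 (hm : 6 ∣ q) (hq : 24 ≤ q) (χ : DirichletCharacter ℂ q) :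
    WeilPositivityOnChar χ 1 := by
  rcases Nat.le_one_iff_eq_zero_or_eq_one.1 (charParity_le_one χ) with h | h
  · exact weilPositivityOnChar_one_of_even_six_dvd_ge_24 hm hq χ h
  · exact weilPositivityOnChar_one_of_odd_six_dvd_ge_12 hm (by omega) χ h

/-- The same on every window `t ≤ 1`. [folklore] -/
theorem weilPositivityOnChar_of_le_one_of_six_dvd_ge_24 (hm : 6 ∣ q) (hq : 24 ≤ q) (χ : DirichletCharacter ℂ q) {t : ℝ}
    (ht : t ≤ 1) : WeilPositivityOnChar χ t := fun g hg hsupp ↦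
  weilPositivityOnChar_one_of_six_dvd_ge_24 hm hq χ g hg (hsupp.trans (Icc_subset_Icc (by linarith) ht))

/-- Odd characters on every window `t ≤ 1` from `6 ∣ q`, `q ≥ 12`. [folklore] -/
theorem weilPositivityOnChar_of_le_one_of_odd_six_dvd_ge_12 (hm : 6 ∣ q) (hq : 12 ≤ q) (χ : DirichletCharacter ℂ q)
    (hpar : charParity χ = 1) {t : ℝ} (ht : t ≤ 1) : WeilPositivityOnChar χ t := fun g hg hsupp ↦
  weilPositivityOnChar_one_of_odd_six_dvd_ge_12 hm hq χ hpar g hg (hsupp.trans (Icc_subset_Icc (by linarith) ht))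

end UniformFloor

end Summit.Ventures.WeilGRH

end
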